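import Mathlib
import Summits.Ventures.PercRepro2.StarBXhatA

/-!
# The mean field `X̂` when `a₃` is adjacent only to `a₁`, `a₂` and `b`, part B: the row sums and
the assembly (blind cell PercRepro2, night-1 g9; NIGHT1-G8.md §2, NIGHT1-G9.md §2)

The `f₃`-outcomes through `StarBXhatA.sum_rows_of_outc_b` and the glue lemmas; the rows with the
`b`-coin closed are those of class O with the third vertex renamed (`sum_ccc_rows_b`,
`sum_f1_rows_b`, `sum_f2_rows_b`).  Result (`Xhat_star_b`):

  `X̂ = ᾱβ̄s̄·X₀ + αβ̄s̄·Y_T′ + ᾱβs̄·Y_T + ᾱβ̄s·(P_HL + P_LH) + αβ̄s·(A_H − P_HH) + ᾱβs·(A_L − P_LL)`,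

the `XhatMass` of StarBCert.
-/

namespace Summit.Ventures.PercRepro2

open StarGlue PendantRoot UnionCluster StarO

namespace StarB

section Sums

variable {V : Type*} {E : Type*} [Fintype E] [DecidableEq E] [Fintype V] [DecidableEq V]
  {R : Type*} [Field R] [LinearOrder R] [IsStrictOrderedRing R]

variable (p : E → R) (ends : E → Sym2 V) {f₁ f₂ f₃ : E} {a₃ a₁ a₂ o b : V}

/-! ## The glue evaluation of the outcomes with a root coin and the `b`-coin open -/

omit [Fintype E] [DecidableEq E] in
/-- With the `a₁`- and `b`-coins open: `{a₂ ∉ C(a₃), a₂ ↔ o}` is `Q₁ ∩ {b ∉ C₂} ∩ {o ∈ C₂}` seen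
through the closed star (`a₁ ∈ C(a₃)` holds automatically). -/
lemma outc_f13_left (hf₁ : ends f₁ = s(a₃, a₁)) (hf₂ : ends f₂ = s(a₃, a₂))
    (hf₃ : ends f₃ = s(a₃, b)) (hstar : ∀ e, a₃ ∈ ends e → e = f₁ ∨ e = f₂ ∨ e = f₃)
    (h31 : a₃ ≠ a₁) (h32 : a₃ ≠ a₂) (h3o : a₃ ≠ o) (h3b : a₃ ≠ b) :
    outc f₁ f₂ f₃ true false true ∩ connEvent ends a₃ a₁ ∩ (connEvent ends a₃ a₂)ᶜ ∩
        connEvent ends a₂ o =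
      viaStar ends a₃ (avoidAll ends a₂ {a₁} ∩ (connEvent ends a₂ b)ᶜ ∩ connEvent ends a₂ o) ∩
        outc f₁ f₂ f₃ true false true := by
  ext ω
  simp only [Set.mem_inter_iff, Set.mem_compl_iff, mem_connEvent, mem_outc, viaStar,
    Set.mem_setOf_eq, avoidAll_eq_compl]
  have hadj : ∀ m, OpenAdj ends ω a₃ m ↔ (ω f₁ = true ∧ m = a₁) ∨ (ω f₂ = true ∧ m = a₂) ∨
      (ω f₃ = true ∧ m = b) := fun m => openAdj_a3_iff hf₁ hf₂ hf₃ hstar h31 h32 h3b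
  constructor
  · rintro ⟨⟨⟨⟨h1, h2, h3⟩, -⟩, hn2⟩, hc⟩
    rw [conn_a3_iff_glue h32.symm] at hn2
    rw [conn_iff_glue13 hf₁ hf₂ hf₃ hstar h31 h32 h3b h1 h2 h3 h32.symm h3o.symm] at hc
    have hn1 : ¬ Conn ends (closeStar ends a₃ ω) a₁ a₂ := fun h =>
      hn2 ⟨a₁, (hadj a₁).2 (Or.inl ⟨h1, rfl⟩), h⟩
    have hnb : ¬ Conn ends (closeStar ends a₃ ω) b a₂ := fun h =>
      hn2 ⟨b, (hadj b).2 (Or.inr (Or.inr ⟨h3, rfl⟩)), h⟩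
    refine ⟨⟨⟨hn1, fun h => hnb (conn_symm h)⟩, ?_⟩, h1, h2, h3⟩
    rcases hc with h | ⟨h, _⟩ | ⟨h, _⟩
    · exact h
    · exact absurd (conn_symm h) hn1
    · exact absurd (conn_symm h) hnb
  · rintro ⟨⟨⟨hQ, hnb⟩, hc⟩, h1, h2, h3⟩
    refine ⟨⟨⟨⟨h1, h2, h3⟩, conn_of_openAdj ((hadj a₁).2 (Or.inl ⟨h1, rfl⟩))⟩, ?_⟩, ?_⟩
    · rw [conn_a3_iff_glue h32.symm]
      rintro ⟨m, hm, hm2⟩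
      rcases (hadj m).1 hm with ⟨_, rfl⟩ | ⟨hf, _⟩ | ⟨_, rfl⟩
      · exact hQ hm2
      · rw [h2] at hf; exact Bool.false_ne_true hf
      · exact hnb (conn_symm hm2)
    · rw [conn_iff_glue13 hf₁ hf₂ hf₃ hstar h31 h32 h3b h1 h2 h3 h32.symm h3o.symm]
      exact Or.inl hc

omit [Fintype E] [DecidableEq E] [Fintype V] [DecidableEq V] in
/-- With the `a₁`-coin open, `a₁ ∈ C(a₃)`: the right-hand row class is empty. -/
lemma outc_f1_right_empty (hf₁ : ends f₁ = s(a₃, a₁)) (b₂ b₃ : Bool) :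
    outc f₁ f₂ f₃ true b₂ b₃ ∩ connEvent ends a₃ a₂ ∩ (connEvent ends a₃ a₁)ᶜ ∩
        connEvent ends a₁ o = ∅ := by
  ext ω
  simp only [Set.mem_inter_iff, Set.mem_compl_iff, mem_connEvent, mem_outc,
    Set.mem_empty_iff_false, iff_false]
  rintro ⟨⟨⟨⟨h1, -, -⟩, -⟩, hn⟩, -⟩
  exact hn (conn_of_openAdj ⟨f₁, h1, hf₁⟩)

omit [Fintype E] [DecidableEq E] [Fintype V] [DecidableEq V] in
/-- With the `a₂`-coin open, `a₂ ∈ C(a₃)`: the left-hand row class is empty. -/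
lemma outc_f2_left_empty (hf₂ : ends f₂ = s(a₃, a₂)) (b₁ b₃ : Bool) :
    outc f₁ f₂ f₃ b₁ true b₃ ∩ connEvent ends a₃ a₁ ∩ (connEvent ends a₃ a₂)ᶜ ∩
        connEvent ends a₂ o = ∅ := by
  ext ω
  simp only [Set.mem_inter_iff, Set.mem_compl_iff, mem_connEvent, mem_outc,
    Set.mem_empty_iff_false, iff_false]
  rintro ⟨⟨⟨⟨-, h2, -⟩, -⟩, hn⟩, -⟩
  exact hn (conn_of_openAdj ⟨f₂, h2, hf₂⟩)

omit [Fintype E] [DecidableEq E] in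
/-- With the `a₂`- and `b`-coins open: `{a₁ ∉ C(a₃), a₁ ↔ o}` is `Q₁ ∩ {b ∉ C₁} ∩ {o ∈ C₁}` seen
through the closed star. -/
lemma outc_f23_right (hf₁ : ends f₁ = s(a₃, a₁)) (hf₂ : ends f₂ = s(a₃, a₂))
    (hf₃ : ends f₃ = s(a₃, b)) (hstar : ∀ e, a₃ ∈ ends e → e = f₁ ∨ e = f₂ ∨ e = f₃)
    (h31 : a₃ ≠ a₁) (h32 : a₃ ≠ a₂) (h3o : a₃ ≠ o) (h3b : a₃ ≠ b) :
    outc f₁ f₂ f₃ false true true ∩ connEvent ends a₃ a₂ ∩ (connEvent ends a₃ a₁)ᶜ ∩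
        connEvent ends a₁ o =
      viaStar ends a₃ (avoidAll ends a₂ {a₁} ∩ (connEvent ends a₁ b)ᶜ ∩ connEvent ends a₁ o) ∩
        outc f₁ f₂ f₃ false true true := by
  ext ω
  simp only [Set.mem_inter_iff, Set.mem_compl_iff, mem_connEvent, mem_outc, viaStar,
    Set.mem_setOf_eq, avoidAll_eq_compl]
  have hadj : ∀ m, OpenAdj ends ω a₃ m ↔ (ω f₁ = true ∧ m = a₁) ∨ (ω f₂ = true ∧ m = a₂) ∨
      (ω f₃ = true ∧ m = b) := fun m => openAdj_a3_iff hf₁ hf₂ hf₃ hstar h31 h32 h3b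
  constructor
  · rintro ⟨⟨⟨⟨h1, h2, h3⟩, -⟩, hn1⟩, hc⟩
    rw [conn_a3_iff_glue h31.symm] at hn1
    rw [conn_iff_glue23 hf₁ hf₂ hf₃ hstar h31 h32 h3b h1 h2 h3 h31.symm h3o.symm] at hc
    have hn2 : ¬ Conn ends (closeStar ends a₃ ω) a₂ a₁ := fun h =>
      hn1 ⟨a₂, (hadj a₂).2 (Or.inr (Or.inl ⟨h2, rfl⟩)), h⟩
    have hnb : ¬ Conn ends (closeStar ends a₃ ω) b a₁ := fun h =>
      hn1 ⟨b, (hadj b).2 (Or.inr (Or.inr ⟨h3, rfl⟩)), h⟩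
    refine ⟨⟨⟨fun h => hn2 (conn_symm h), fun h => hnb (conn_symm h)⟩, ?_⟩, h1, h2, h3⟩
    rcases hc with h | ⟨h, _⟩ | ⟨h, _⟩
    · exact h
    · exact absurd (conn_symm h) hn2
    · exact absurd (conn_symm h) hnb
  · rintro ⟨⟨⟨hQ, hnb⟩, hc⟩, h1, h2, h3⟩
    refine ⟨⟨⟨⟨h1, h2, h3⟩, conn_of_openAdj ((hadj a₂).2 (Or.inr (Or.inl ⟨h2, rfl⟩)))⟩, ?_⟩, ?_⟩
    · rw [conn_a3_iff_glue h31.symm]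
      rintro ⟨m, hm, hm1⟩
      rcases (hadj m).1 hm with ⟨hf, _⟩ | ⟨_, rfl⟩ | ⟨_, rfl⟩
      · rw [h1] at hf; exact Bool.false_ne_true hf
      · exact hQ (conn_symm hm1)
      · exact hnb (conn_symm hm1)
    · rw [conn_iff_glue23 hf₁ hf₂ hf₃ hstar h31 h32 h3b h1 h2 h3 h31.symm h3o.symm]
      exact Or.inl hc

omit [LinearOrder R] [IsStrictOrderedRing R] in
/-- `P(viaStar A ∩ outc) = P₀(A) · (coin weights)`. -/
lemma prob_viaStar_inter_outc (hf₁ : ends f₁ = s(a₃, a₁)) (hf₂ : ends f₂ = s(a₃, a₂))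
    (hf₃ : ends f₃ = s(a₃, b)) (h12 : f₁ ≠ f₂) (h13 : f₁ ≠ f₃) (h23 : f₂ ≠ f₃)
    (A : Set (Config E)) (b₁ b₂ b₃ : Bool) :
    prob p (viaStar ends a₃ A ∩ outc f₁ f₂ f₃ b₁ b₂ b₃) =
      prob (pOut p ends a₃) A * cw b₁ (p f₁) * cw b₂ (p f₂) * cw b₃ (p f₃) := by
  have hf1 : a₃ ∈ ends f₁ := by rw [hf₁]; exact Sym2.mem_mk_left _ _
  have hf2 : a₃ ∈ ends f₂ := by rw [hf₂]; exact Sym2.mem_mk_left _ _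
  have hf3 : a₃ ∈ ends f₃ := by rw [hf₃]; exact Sym2.mem_mk_left _ _
  rw [prob_inter_outc p h12 h13 h23 (free_viaStar ends a₃ hf1 A) (free_viaStar ends a₃ hf2 A)
    (free_viaStar ends a₃ hf3 A), prob_viaStar]

omit [LinearOrder R] [IsStrictOrderedRing R] in
/-- **The `f₃`-rows**: `ᾱβ̄s · [P₀(Q, b ∈ C₁, o ∈ C₂) + P₀(Q, b ∈ C₂, o ∈ C₁)]`. -/
lemma sum_f3_rows_b (hf₁ : ends f₁ = s(a₃, a₁)) (hf₂ : ends f₂ = s(a₃, a₂))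
    (hf₃ : ends f₃ = s(a₃, b)) (hstar : ∀ e, a₃ ∈ ends e → e = f₁ ∨ e = f₂ ∨ e = f₃)
    (h31 : a₃ ≠ a₁) (h32 : a₃ ≠ a₂) (h3o : a₃ ≠ o) (h3b : a₃ ≠ b) (h12 : f₁ ≠ f₂) (h13 : f₁ ≠ f₃)
    (h23 : f₂ ≠ f₃) :
    ∑ W : Finset V, prob p (clusterEvent ends a₃ (↑W : Set V) ∩ outc f₁ f₂ f₃ false false true) *
        termW p ends o a₁ a₂ b W =
      (1 - p f₁) * (1 - p f₂) * p f₃ *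
        (prob (pOut p ends a₃) (avoidAll ends a₂ {a₁} ∩ connEvent ends a₁ b ∩ connEvent ends a₂ o) +
          prob (pOut p ends a₃) (avoidAll ends a₂ {a₁} ∩ connEvent ends a₂ b ∩ connEvent ends a₁ o)) := by
  rw [sum_rows_of_outc_b p ends hf₁ hf₂ hf₃, outc_f3_left ends hf₁ hf₂ hf₃ hstar h31 h32 h3o h3b,
    outc_f3_right ends hf₁ hf₂ hf₃ hstar h31 h32 h3o h3b,
    prob_viaStar_inter_outc p ends hf₁ hf₂ hf₃ h12 h13 h23,
    prob_viaStar_inter_outc p ends hf₁ hf₂ hf₃ h12 h13 h23]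
  simp only [cw, ↓reduceIte, Bool.false_eq_true]
  ring

omit [LinearOrder R] [IsStrictOrderedRing R] in
/-- **The `f₁f₃`-rows**: `αβ̄s · P₀(Q, b ∉ C₂, o ∈ C₂)`. -/
lemma sum_f13_rows_b (hf₁ : ends f₁ = s(a₃, a₁)) (hf₂ : ends f₂ = s(a₃, a₂))
    (hf₃ : ends f₃ = s(a₃, b)) (hstar : ∀ e, a₃ ∈ ends e → e = f₁ ∨ e = f₂ ∨ e = f₃)
    (h31 : a₃ ≠ a₁) (h32 : a₃ ≠ a₂) (h3o : a₃ ≠ o) (h3b : a₃ ≠ b) (h12 : f₁ ≠ f₂) (h13 : f₁ ≠ f₃)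
    (h23 : f₂ ≠ f₃) :
    ∑ W : Finset V, prob p (clusterEvent ends a₃ (↑W : Set V) ∩ outc f₁ f₂ f₃ true false true) *
        termW p ends o a₁ a₂ b W =
      p f₁ * (1 - p f₂) * p f₃ *
        prob (pOut p ends a₃) (avoidAll ends a₂ {a₁} ∩ (connEvent ends a₂ b)ᶜ ∩ connEvent ends a₂ o) := by
  rw [sum_rows_of_outc_b p ends hf₁ hf₂ hf₃, outc_f13_left ends hf₁ hf₂ hf₃ hstar h31 h32 h3o h3b,
    outc_f1_right_empty ends hf₁, prob_empty, add_zero,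
    prob_viaStar_inter_outc p ends hf₁ hf₂ hf₃ h12 h13 h23]
  simp only [cw, ↓reduceIte, Bool.false_eq_true]
  ring

omit [LinearOrder R] [IsStrictOrderedRing R] in
/-- **The `f₂f₃`-rows**: `ᾱβs · P₀(Q, b ∉ C₁, o ∈ C₁)`. -/
lemma sum_f23_rows_b (hf₁ : ends f₁ = s(a₃, a₁)) (hf₂ : ends f₂ = s(a₃, a₂))
    (hf₃ : ends f₃ = s(a₃, b)) (hstar : ∀ e, a₃ ∈ ends e → e = f₁ ∨ e = f₂ ∨ e = f₃)
    (h31 : a₃ ≠ a₁) (h32 : a₃ ≠ a₂) (h3o : a₃ ≠ o) (h3b : a₃ ≠ b) (h12 : f₁ ≠ f₂) (h13 : f₁ ≠ f₃)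
    (h23 : f₂ ≠ f₃) :
    ∑ W : Finset V, prob p (clusterEvent ends a₃ (↑W : Set V) ∩ outc f₁ f₂ f₃ false true true) *
        termW p ends o a₁ a₂ b W =
      (1 - p f₁) * p f₂ * p f₃ *
        prob (pOut p ends a₃) (avoidAll ends a₂ {a₁} ∩ (connEvent ends a₁ b)ᶜ ∩ connEvent ends a₁ o) := by
  rw [sum_rows_of_outc_b p ends hf₁ hf₂ hf₃, outc_f23_right ends hf₁ hf₂ hf₃ hstar h31 h32 h3o h3b,
    outc_f2_left_empty ends hf₂, prob_empty, zero_add,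
    prob_viaStar_inter_outc p ends hf₁ hf₂ hf₃ h12 h13 h23]
  simp only [cw, ↓reduceIte, Bool.false_eq_true]
  ring

omit [LinearOrder R] [IsStrictOrderedRing R] in
/-- The rows with all three coins open carry no mean-field weight. -/
lemma sum_f123_rows_b (hf₁ : ends f₁ = s(a₃, a₁)) (hf₂ : ends f₂ = s(a₃, a₂))
    (hf₃ : ends f₃ = s(a₃, b)) :
    ∑ W : Finset V, prob p (clusterEvent ends a₃ (↑W : Set V) ∩ outc f₁ f₂ f₃ true true true) *
        termW p ends o a₁ a₂ b W = 0 := by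
  rw [sum_rows_of_outc_b p ends hf₁ hf₂ hf₃, outc_f2_left_empty ends hf₂,
    outc_f1_right_empty ends hf₁, prob_empty, add_zero]

omit [LinearOrder R] [IsStrictOrderedRing R] in
/-- Rows with both root coins open carry no mean-field weight (class O's lemma, any third vertex). -/
lemma sum_f12_rows_zero_b (hf₁ : ends f₁ = s(a₃, a₁)) (hf₂ : ends f₂ = s(a₃, a₂)) (b₃ : Bool) :
    ∑ W : Finset V, prob p (clusterEvent ends a₃ (↑W : Set V) ∩ outc f₁ f₂ f₃ true true b₃) *
        termW p ends o a₁ a₂ b W = 0 := by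
  refine Finset.sum_eq_zero fun W _ => ?_
  by_cases h : a₁ ∈ W ∧ a₂ ∈ W
  · simp [termW, h.1, h.2]
  · rw [clusterEvent_a3_inter_outc_f12 ends hf₁ hf₂ h, prob_empty, zero_mul]

omit [LinearOrder R] [IsStrictOrderedRing R] in
/-- The all-closed row is the isolated term (class O's lemma with the third vertex `b`). -/
lemma sum_ccc_rows_b (hf₁ : ends f₁ = s(a₃, a₁)) (hf₂ : ends f₂ = s(a₃, a₂))
    (hf₃ : ends f₃ = s(a₃, b)) (hstar : ∀ e, a₃ ∈ ends e → e = f₁ ∨ e = f₂ ∨ e = f₃)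
    (h31 : a₃ ≠ a₁) (h32 : a₃ ≠ a₂) (h3b : a₃ ≠ b) (h12 : f₁ ≠ f₂) (h13 : f₁ ≠ f₃) (h23 : f₂ ≠ f₃) :
    ∑ W : Finset V, prob p (clusterEvent ends a₃ (↑W : Set V) ∩ outc f₁ f₂ f₃ false false false) *
        termW p ends o a₁ a₂ b W =
      (1 - p f₁) * (1 - p f₂) * (1 - p f₃) * termW p ends o a₁ a₂ b {a₃} := by
  have hw : prob p (outc f₁ f₂ f₃ false false false) = (1 - p f₁) * (1 - p f₂) * (1 - p f₃) := by
    have := prob_inter_outc p h12 h13 h23 (A := Set.univ) (fun _ _ _ => rfl) (fun _ _ _ => rfl)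
      (fun _ _ _ => rfl) false false false
    rwa [Set.univ_inter, prob_univ, one_mul] at this
  simp only [clusterEvent_a3_inter_outc_ccc ends hf₁ hf₂ hf₃ hstar h31 h32 h3b]
  rw [Finset.sum_eq_single ({a₃} : Finset V)]
  · rw [if_pos rfl, hw]
  · intro W _ hW
    rw [if_neg hW, prob_empty, zero_mul]
  · intro h; exact absurd (Finset.mem_univ _) h

omit [LinearOrder R] [IsStrictOrderedRing R] in
/-- The `f₁`-rows of `X̂`: the light row sum at the star-zeroed weights (class O's lemma with the
third vertex `b`). -/
lemma sum_f1_rows_b (hf₁ : ends f₁ = s(a₃, a₁)) (hf₂ : ends f₂ = s(a₃, a₂))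
    (hf₃ : ends f₃ = s(a₃, b)) (hstar : ∀ e, a₃ ∈ ends e → e = f₁ ∨ e = f₂ ∨ e = f₃)
    (h31 : a₃ ≠ a₁) (h32 : a₃ ≠ a₂) (h3o : a₃ ≠ o) (h3b : a₃ ≠ b) (h12 : f₁ ≠ f₂) (h13 : f₁ ≠ f₃)
    (h23 : f₂ ≠ f₃) :
    ∑ W : Finset V, prob p (clusterEvent ends a₃ (↑W : Set V) ∩ outc f₁ f₂ f₃ true false false) *
        termW p ends o a₁ a₂ b W =
      p f₁ * (1 - p f₂) * (1 - p f₃) * lightSum ends (pOut p ends a₃) o a₁ a₂ b := by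
  have fac : ∀ (A : Set (Config E)),
      prob p (viaStar ends a₃ A ∩ outc f₁ f₂ f₃ true false false) =
        prob (pOut p ends a₃) A * p f₁ * (1 - p f₂) * (1 - p f₃) := by
    intro A
    rw [prob_viaStar_inter_outc p ends hf₁ hf₂ hf₃ h12 h13 h23]
    simp [cw]
  simp only [clusterEvent_a3_inter_outc_f1 ends hf₁ hf₂ hf₃ hstar h31 h32 h3b]
  rw [← sum_cluster_termW_eq_lightSum p ends, Finset.mul_sum]
  set F : Finset V → R := fun W => prob p (if a₃ ∈ W then
    viaStar ends a₃ (clusterEvent ends a₁ (↑(W.erase a₃) : Set V)) ∩ outc f₁ f₂ f₃ true false false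
    else ∅) * termW p ends o a₁ a₂ b W with hF
  set G : Finset V → R := fun W => p f₁ * (1 - p f₂) * (1 - p f₃) *
    (prob (pOut p ends a₃) (clusterEvent ends a₁ (↑W : Set V)) *
      termW (pOut p ends a₃) ends o a₁ a₂ b W) with hG
  have hL := Finset.sum_filter_add_sum_filter_not Finset.univ (fun W : Finset V => a₃ ∈ W) F
  have hR := Finset.sum_filter_add_sum_filter_not Finset.univ (fun W : Finset V => a₃ ∈ W) G
  have hL0 : ∑ W ∈ Finset.univ.filter (fun W : Finset V => ¬ a₃ ∈ W), F W = 0 := by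
    refine Finset.sum_eq_zero fun W hW => ?_
    simp only [hF, if_neg (Finset.mem_filter.1 hW).2, prob_empty, zero_mul]
  have hR0 : ∑ W ∈ Finset.univ.filter (fun W : Finset V => a₃ ∈ W), G W = 0 := by
    refine Finset.sum_eq_zero fun W hW => ?_
    simp only [hG, prob_pOut_clusterEvent_of_mem p ends h31.symm (Finset.mem_filter.1 hW).2,
      zero_mul, mul_zero]
  show ∑ W, F W = ∑ W, G W
  rw [← hL, ← hR, hL0, hR0, add_zero, zero_add]
  refine Finset.sum_bij' (fun W _ => W.erase a₃) (fun W' _ => insert a₃ W') ?_ ?_ ?_ ?_ ?_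
  · intro W hW
    simp only [Finset.mem_filter, Finset.mem_univ, true_and, Finset.mem_erase, ne_eq,
      not_true_eq_false, false_and, not_false_eq_true]
  · intro W' hW'
    simp only [Finset.mem_filter, Finset.mem_univ, true_and, Finset.mem_insert, true_or]
  · intro W hW
    exact Finset.insert_erase (Finset.mem_filter.1 hW).2
  · intro W' hW'
    exact Finset.erase_insert (Finset.mem_filter.1 hW').2
  · intro W hW
    have h3W : a₃ ∈ W := (Finset.mem_filter.1 hW).2
    simp only [hF, hG, if_pos h3W, fac]
    have : W = insert a₃ (W.erase a₃) := (Finset.insert_erase h3W).symm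
    conv_lhs => rw [this]
    rw [termW_insert_a3 p ends (W.erase a₃) h31 h32 h3o h3b, Finset.erase_insert
      (Finset.notMem_erase a₃ W)]
    ring

omit [LinearOrder R] [IsStrictOrderedRing R] in
/-- The `f₂`-rows of `X̂`: the heavy row sum at the star-zeroed weights (class O's lemma with the
third vertex `b`). -/
lemma sum_f2_rows_b (hf₁ : ends f₁ = s(a₃, a₁)) (hf₂ : ends f₂ = s(a₃, a₂))
    (hf₃ : ends f₃ = s(a₃, b)) (hstar : ∀ e, a₃ ∈ ends e → e = f₁ ∨ e = f₂ ∨ e = f₃)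
    (h31 : a₃ ≠ a₁) (h32 : a₃ ≠ a₂) (h3o : a₃ ≠ o) (h3b : a₃ ≠ b) (h12 : f₁ ≠ f₂) (h13 : f₁ ≠ f₃)
    (h23 : f₂ ≠ f₃) :
    ∑ W : Finset V, prob p (clusterEvent ends a₃ (↑W : Set V) ∩ outc f₁ f₂ f₃ false true false) *
        termW p ends o a₁ a₂ b W =
      (1 - p f₁) * p f₂ * (1 - p f₃) * heavySum ends (pOut p ends a₃) o a₁ a₂ b := by
  have fac : ∀ (A : Set (Config E)),
      prob p (viaStar ends a₃ A ∩ outc f₁ f₂ f₃ false true false) =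
        prob (pOut p ends a₃) A * (1 - p f₁) * p f₂ * (1 - p f₃) := by
    intro A
    rw [prob_viaStar_inter_outc p ends hf₁ hf₂ hf₃ h12 h13 h23]
    simp [cw]
  simp only [clusterEvent_a3_inter_outc_f2 ends hf₁ hf₂ hf₃ hstar h31 h32 h3b]
  rw [← sum_cluster_termW_eq_heavySum p ends, Finset.mul_sum]
  set F : Finset V → R := fun W => prob p (if a₃ ∈ W then
    viaStar ends a₃ (clusterEvent ends a₂ (↑(W.erase a₃) : Set V)) ∩ outc f₁ f₂ f₃ false true false
    else ∅) * termW p ends o a₁ a₂ b W with hF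
  set G : Finset V → R := fun W => (1 - p f₁) * p f₂ * (1 - p f₃) *
    (prob (pOut p ends a₃) (clusterEvent ends a₂ (↑W : Set V)) *
      termW (pOut p ends a₃) ends o a₁ a₂ b W) with hG
  have hL := Finset.sum_filter_add_sum_filter_not Finset.univ (fun W : Finset V => a₃ ∈ W) F
  have hR := Finset.sum_filter_add_sum_filter_not Finset.univ (fun W : Finset V => a₃ ∈ W) G
  have hL0 : ∑ W ∈ Finset.univ.filter (fun W : Finset V => ¬ a₃ ∈ W), F W = 0 := by
    refine Finset.sum_eq_zero fun W hW => ?_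
    simp only [hF, if_neg (Finset.mem_filter.1 hW).2, prob_empty, zero_mul]
  have hR0 : ∑ W ∈ Finset.univ.filter (fun W : Finset V => a₃ ∈ W), G W = 0 := by
    refine Finset.sum_eq_zero fun W hW => ?_
    simp only [hG, prob_pOut_clusterEvent_of_mem p ends h32.symm (Finset.mem_filter.1 hW).2,
      zero_mul, mul_zero]
  show ∑ W, F W = ∑ W, G W
  rw [← hL, ← hR, hL0, hR0, add_zero, zero_add]
  refine Finset.sum_bij' (fun W _ => W.erase a₃) (fun W' _ => insert a₃ W') ?_ ?_ ?_ ?_ ?_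
  · intro W hW
    simp only [Finset.mem_filter, Finset.mem_univ, true_and, Finset.mem_erase, ne_eq,
      not_true_eq_false, false_and, not_false_eq_true]
  · intro W' hW'
    simp only [Finset.mem_filter, Finset.mem_univ, true_and, Finset.mem_insert, true_or]
  · intro W hW
    exact Finset.insert_erase (Finset.mem_filter.1 hW).2
  · intro W' hW'
    exact Finset.erase_insert (Finset.mem_filter.1 hW').2
  · intro W hW
    have h3W : a₃ ∈ W := (Finset.mem_filter.1 hW).2
    simp only [hF, hG, if_pos h3W, fac]
    have : W = insert a₃ (W.erase a₃) := (Finset.insert_erase h3W).symm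
    conv_lhs => rw [this]
    rw [termW_insert_a3 p ends (W.erase a₃) h31 h32 h3o h3b, Finset.erase_insert
      (Finset.notMem_erase a₃ W)]
    ring

omit [LinearOrder R] [IsStrictOrderedRing R] in
/-- **The mean field at the three-coin star of class B**:
`X̂ = ᾱβ̄s̄ X₀ + αβ̄s̄ Y_T′ + ᾱβs̄ Y_T + ᾱβ̄s (P_HL + P_LH) + αβ̄s (A_H − P_HH) + ᾱβs (A_L − P_LL)`
with the row sums and the cells at the star-zeroed weights. -/
theorem Xhat_star_b (hf₁ : ends f₁ = s(a₃, a₁)) (hf₂ : ends f₂ = s(a₃, a₂))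
    (hf₃ : ends f₃ = s(a₃, b)) (hstar : ∀ e, a₃ ∈ ends e → e = f₁ ∨ e = f₂ ∨ e = f₃)
    (h31 : a₃ ≠ a₁) (h32 : a₃ ≠ a₂) (h3o : a₃ ≠ o) (h3b : a₃ ≠ b) (h12 : f₁ ≠ f₂) (h13 : f₁ ≠ f₃)
    (h23 : f₂ ≠ f₃) :
    Xhat p ends o a₁ a₂ a₃ b =
      (1 - p f₁) * (1 - p f₂) * (1 - p f₃) * termW p ends o a₁ a₂ b {a₃} +
        p f₁ * (1 - p f₂) * (1 - p f₃) * lightSum ends (pOut p ends a₃) o a₁ a₂ b +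
        (1 - p f₁) * p f₂ * (1 - p f₃) * heavySum ends (pOut p ends a₃) o a₁ a₂ b +
        (1 - p f₁) * (1 - p f₂) * p f₃ *
          (prob (pOut p ends a₃) (avoidAll ends a₂ {a₁} ∩ connEvent ends a₁ b ∩ connEvent ends a₂ o) +
            prob (pOut p ends a₃) (avoidAll ends a₂ {a₁} ∩ connEvent ends a₂ b ∩ connEvent ends a₁ o)) +
        p f₁ * (1 - p f₂) * p f₃ *
          prob (pOut p ends a₃) (avoidAll ends a₂ {a₁} ∩ (connEvent ends a₂ b)ᶜ ∩ connEvent ends a₂ o) +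
        (1 - p f₁) * p f₂ * p f₃ *
          prob (pOut p ends a₃) (avoidAll ends a₂ {a₁} ∩ (connEvent ends a₁ b)ᶜ ∩ connEvent ends a₁ o) := by
  rw [Xhat_eq_sum]
  have hsplit : ∀ W : Finset V, prob p (clusterEvent ends a₃ (↑W : Set V)) * termW p ends o a₁ a₂ b W =
      ∑ b₁ : Bool, ∑ b₂ : Bool, ∑ b₃ : Bool,
        prob p (clusterEvent ends a₃ (↑W : Set V) ∩ outc f₁ f₂ f₃ b₁ b₂ b₃) * termW p ends o a₁ a₂ b W := by
    intro W
    rw [prob_eq_sum_outc p f₁ f₂ f₃ (clusterEvent ends a₃ (↑W : Set V))]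
    simp only [Finset.sum_mul]
  simp only [hsplit, Fintype.sum_bool]
  simp only [Finset.sum_add_distrib]
  rw [sum_f123_rows_b p ends hf₁ hf₂ hf₃, sum_f12_rows_zero_b p ends hf₁ hf₂ false,
    sum_f13_rows_b p ends hf₁ hf₂ hf₃ hstar h31 h32 h3o h3b h12 h13 h23,
    sum_f1_rows_b p ends hf₁ hf₂ hf₃ hstar h31 h32 h3o h3b h12 h13 h23,
    sum_f23_rows_b p ends hf₁ hf₂ hf₃ hstar h31 h32 h3o h3b h12 h13 h23,
    sum_f2_rows_b p ends hf₁ hf₂ hf₃ hstar h31 h32 h3o h3b h12 h13 h23,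
    sum_f3_rows_b p ends hf₁ hf₂ hf₃ hstar h31 h32 h3o h3b h12 h13 h23,
    sum_ccc_rows_b p ends hf₁ hf₂ hf₃ hstar h31 h32 h3b h12 h13 h23]
  ring

end Sums

end StarB

end Summit.Ventures.PercRepro2
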